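import Mathlib.Algebra.Category.ModuleCat.Sheaf.Free
import Mathlib.Algebra.Category.ModuleCat.Sheaf.PullbackFree
import Mathlib.AlgebraicGeometry.Modules.Sheaf

/-!
# The unit of `f^* ⊣ f_*` on a free module of finite rank

Helper file for stub `stub_presentationAlgebraize` (EB2) of line `chow-zariski-pushforward` of the
crux `PadicSemiregularLift.FormalVectorBundlesAlgebraize` (`stmt-HodgeConjecture-14106`). The stub
compares morphisms `V'|Z_m ⟶ V|Z_m` of restrictions of vector bundles along the closed immersions
`ι_m : Z_m ↪ Z` of the `p`-adic tower with sections of `𝓗om(V', V)/p^m`; the geometric input is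
that the unit `V ⟶ ι_{m*} ι_m^* V` of Mathlib's adjunction
`Scheme.Modules.pullbackPushforwardAdjunction ι_m` is an epimorphism with kernel `p^m V` for `V`
finite locally free. Mathlib's inverse image functor `Scheme.Modules.pullback` is an abstract left
adjoint, so everything about the unit has to be derived from the adjunction; this file does it for
FREE modules of finite rank, for an arbitrary morphism of schemes `f : Y ⟶ X`:

* sections of `𝒪^I` (`SheafOfModules.free I`, `I` finite) over any object of the site have
  coordinates: they are the combinations `∑_i a_i • b_i` of the tautological basis sections
  `b_i = (ιFree i)(1)`, with `Γ(𝒪)`-linear coordinate functionals dual to the `b_i`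
  (`free_sections_basis`; derived from Mathlib's universal property `SheafOfModules.freeHomEquiv`
  alone: `∑_i δ_i(–) b_i = 𝟙` is checked on the basis);
* the unit `𝒪_X^I ⟶ f_* f^* 𝒪_X^I`, followed by Mathlib's identification `f^* 𝒪_X^I ≅ 𝒪_Y^I`
  (`SheafOfModules.pullbackObjFreeIso`, available because `f⁻¹ : Opens X ⥤ Opens Y` is final), is
  `∑_i a_i • b_i ↦ ∑_i f♯(a_i) • b_i'` on sections (`unit_free_val_app_sum`; from Mathlib's
  `pullbackPushforwardAdjunction_homEquiv_pullbackObjUnitToUnit`, i.e. the unit on `𝒪_X` is `f♯`);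
* hence on sections over an open `U` on which `f♯` is surjective the unit is surjective
  (`unit_free_app_surjective`), and if `ker (f♯ on U) ⊆ (q)` for a natural number `q`, a section
  killed by the unit is a `q`-th multiple (`unit_free_app_eq_zero`).

Everything is proved; no definitions (the basis sections and dual functionals are local notations).
-/

set_option linter.dupNamespace false
set_option backward.isDefEq.respectTransparency false

noncomputable section

-- Summit.HodgeConjecture.HodgeConjecture.… repeats the summit name by the D-0017 layout (Sub = Summit).

open CategoryTheory CategoryTheory.Limits

universe v₁ u₁ u

namespace Summit.HodgeConjecture.HodgeConjecture.Theorems.FormalVectorBundlesAlgebraize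

/-! ### Sections of a free sheaf of modules of finite rank: the tautological basis -/

open scoped Classical

/-- The tautological basis sections `b_i ∈ Γ(c, 𝒪^I)` of the free module: the images of
`1 ∈ Γ(c, 𝒪)` under the coprojections `ιFree i : 𝒪 ⟶ 𝒪^I`. -/
local notation3 (prettyPrint := false) "𝔟[" R' ", " i ", " c "]" =>
  (SheafOfModules.ιFree (R := R') i).val.app c (1 : (ObjectProperty.FullSubcategory.obj R').obj c)

/-- The dual functionals `δ_i : 𝒪^I ⟶ 𝒪` of the tautological basis (`δ_i(b_j) = [j = i]`). -/
local notation3 (prettyPrint := false) "δ[" R' ", " I' ", " i "]" =>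
  (SheafOfModules.unit R').freeHomEquiv.symm fun j : I' =>
    (SheafOfModules.unit R').unitHomEquiv (if j = i then 𝟙 _ else 0)

section FreeBasis

variable {C : Type u₁} [Category.{v₁} C] {J : GrothendieckTopology C} {R : Sheaf J RingCat.{u}}
  [HasWeakSheafify J AddCommGrpCat.{u}] [J.WEqualsLocallyBijective AddCommGrpCat.{u}]
  {I : Type u}

omit [HasWeakSheafify J AddCommGrpCat.{u}] [J.WEqualsLocallyBijective AddCommGrpCat.{u}] in
/-- Sums of morphisms of sheaves of modules act termwise on elements. -/
theorem sum_val_app_apply {M N : SheafOfModules.{u} R} {κ : Type*} (t : Finset κ) (g : κ → (M ⟶ N))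
    (c : Cᵒᵖ) (x : M.val.obj c) :
    (∑ k ∈ t, g k).val.app c x = ∑ k ∈ t, (g k).val.app c x :=
  map_sum (AddMonoidHom.mk' (fun g : M ⟶ N => g.val.app c x) fun _ _ => rfl) g t

/-- Morphisms out of a free module agreeing on the tautological basis sections are equal. -/
theorem free_hom_ext {N : SheafOfModules.{u} R} (g g' : SheafOfModules.free I ⟶ N)
    (h : ∀ (i : I) (c : Cᵒᵖ), g.val.app c 𝔟[R, i, c] = g'.val.app c 𝔟[R, i, c]) :
    g = g' := by
  apply N.freeHomEquiv.injective
  funext i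
  apply PresheafOfModules.sections_ext
  intro c
  exact h i c

/-- `ιFree j ≫ δ_i = [j = i] 𝟙`. -/
theorem ιFree_freeDual (i j : I) :
    SheafOfModules.ιFree j ≫ δ[R, I, i] = if j = i then 𝟙 _ else 0 := by
  rw [← SheafOfModules.unitHomEquiv_symm_freeHomEquiv_apply, Equiv.apply_symm_apply,
    Equiv.symm_apply_apply]

/-- **The coordinate functionals** `Γ(c, 𝒪^I) → Γ(c, 𝒪)` of the tautological basis exist: they are
`Γ(c, 𝒪)`-linear and dual to the basis sections. -/
theorem exists_freeCoord (i : I) (c : Cᵒᵖ) :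
    ∃ l : (SheafOfModules.free (R := R) I).val.obj c →ₗ[R.obj.obj c] R.obj.obj c,
      (∀ t, l t = (δ[R, I, i]).val.app c t) ∧ ∀ j, l 𝔟[R, j, c] = if j = i then 1 else 0 := by
  refine ⟨((δ[R, I, i]).val.app c).hom, fun t => rfl, fun j => ?_⟩
  change (SheafOfModules.ιFree j ≫ δ[R, I, i]).val.app c (1 : R.obj.obj c) = _
  rw [ιFree_freeDual]
  split_ifs <;> rfl

/-- The coprojections are `a ↦ a • b_i` on sections. -/
theorem ιFree_val_app_apply (i : I) (c : Cᵒᵖ) (a : R.obj.obj c) :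
    (SheafOfModules.ιFree (R := R) i).val.app c a = a • 𝔟[R, i, c] := by
  have h := ((SheafOfModules.ιFree (R := R) i).val.app c).hom.map_smul a (1 : R.obj.obj c)
  refine Eq.trans ?_ h
  congr 1
  exact (mul_one a).symm

variable [Fintype I]

/-- `∑_i δ_i(–) b_i = id` on the free module. -/
theorem sum_freeDual_ιFree :
    ∑ i : I, δ[R, I, i] ≫ SheafOfModules.ιFree i = 𝟙 (SheafOfModules.free I) := by
  refine free_hom_ext _ _ fun j c => ?_
  rw [sum_val_app_apply]
  have h : ∀ i, (δ[R, I, i] ≫ SheafOfModules.ιFree i).val.app c 𝔟[R, j, c] =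
      if j = i then 𝔟[R, i, c] else 0 := by
    intro i
    obtain ⟨l, hl, hlb⟩ := exists_freeCoord (R := R) i c
    change (SheafOfModules.ιFree i).val.app c ((δ[R, I, i]).val.app c 𝔟[R, j, c]) = _
    rw [← hl, hlb, ιFree_val_app_apply, ite_smul, one_smul, zero_smul]
  simp_rw [h, Finset.sum_ite_eq, Finset.mem_univ, if_true]
  rfl

/-- **Sections of `𝒪^I` (`I` finite) have coordinates**: over every object `c`, every section is
`∑_i l_i(t) • b_i` for `Γ(c, 𝒪)`-linear coordinate functionals `l_i` dual to the tautological basis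
sections `b_i`; in particular `∑_i a_i • b_i = 0` forces `a = 0`. -/
theorem free_sections_basis (c : Cᵒᵖ) :
    ∃ l : I → ((SheafOfModules.free (R := R) I).val.obj c →ₗ[R.obj.obj c] R.obj.obj c),
      (∀ i j, l i 𝔟[R, j, c] = if j = i then 1 else 0) ∧
      (∀ t, t = ∑ i, l i t • 𝔟[R, i, c]) ∧
      ∀ a : I → R.obj.obj c, ∀ i, l i (∑ j, a j • 𝔟[R, j, c]) = a i := by
  choose l hl hlb using fun i => exists_freeCoord (R := R) (I := I) i c
  have hsum : ∀ (a : I → R.obj.obj c) (i), l i (∑ j, a j • 𝔟[R, j, c]) = a i := by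
    intro a i
    rw [map_sum]
    have h : ∀ j, l i (a j • 𝔟[R, j, c]) = if j = i then a i else 0 := by
      intro j
      rw [map_smul, hlb, smul_ite, smul_zero, smul_eq_mul, mul_one]
      split_ifs with hj
      · rw [hj]
      · rfl
    simp_rw [h, Finset.sum_ite_eq', Finset.mem_univ, if_true]
  refine ⟨l, hlb, fun t => ?_, hsum⟩
  have h := congrArg (fun g => (SheafOfModules.Hom.val g).app c t)
    (sum_freeDual_ιFree (R := R) (I := I))
  simp only at h
  rw [sum_val_app_apply] at h
  calc t = ∑ k, (δ[R, I, k] ≫ SheafOfModules.ιFree k).val.app c t := h.symm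
    _ = _ := Finset.sum_congr rfl fun i _ => by
      change (SheafOfModules.ιFree i).val.app c ((δ[R, I, i]).val.app c t) = _
      rw [← hl]
      exact ιFree_val_app_apply i c _

end FreeBasis

/-! ### The unit of `f^* ⊣ f_*` on a free module of finite rank -/

section UnitFree

open AlgebraicGeometry TopologicalSpace Opposite

variable {X Y : Scheme.{u}} (f : Y ⟶ X) (I : Type u)

/-- **The unit on the coprojections of `𝒪_X^I`**: identifying `f^* 𝒪_X^I ≅ 𝒪_Y^I` (Mathlib
`SheafOfModules.pullbackObjFreeIso`, the functor `f⁻¹` on opens being final), the unit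
`𝒪_X^I ⟶ f_* f^* 𝒪_X^I ≅ f_* 𝒪_Y^I` restricted to the `i`-th copy of `𝒪_X` is `f♯ : 𝒪_X ⟶ f_* 𝒪_Y`
followed by the `i`-th coprojection (sheaves of modules over the ringed sites of `X`, `Y`). -/
theorem ιFree_unit_pullbackObjFreeIso [(Opens.map f.base).Final] (i : I) :
    SheafOfModules.ιFree i ≫
      (SheafOfModules.pullbackPushforwardAdjunction f.toRingCatSheafHom).unit.app
        (SheafOfModules.free I) ≫
        (SheafOfModules.pushforward f.toRingCatSheafHom).map
          (SheafOfModules.pullbackObjFreeIso f.toRingCatSheafHom I).hom =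
    SheafOfModules.unitToPushforwardObjUnit f.toRingCatSheafHom ≫
      (SheafOfModules.pushforward f.toRingCatSheafHom).map (SheafOfModules.ιFree i) := by
  rw [← (SheafOfModules.pullbackPushforwardAdjunction f.toRingCatSheafHom).unit_naturality_assoc,
    ← Functor.map_comp,
    SheafOfModules.pullback_map_ιFree_comp_pullbackObjFreeIso_hom, Functor.map_comp,
    ← Category.assoc, ← Adjunction.homEquiv_unit,
    SheafOfModules.pullbackPushforwardAdjunction_homEquiv_pullbackObjUnitToUnit]

variable [(Opens.map f.base).Final] [Fintype I] (U : X.Opens)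

/-- On sections over `U`: the unit followed by the identification `f_* f^* 𝒪_X^I ≅ f_* 𝒪_Y^I` sends
`∑_i a_i • b_i` (`b_i` the basis sections of `𝒪_X^I` over `U`) to `∑_i f♯(a_i) • b_i'` (`b_i'` the
basis sections of `𝒪_Y^I` over `f⁻¹U`). -/
theorem unit_free_val_app_sum (a : I → Γ(X, U)) :
    ((SheafOfModules.pullbackPushforwardAdjunction f.toRingCatSheafHom).unit.app
        (SheafOfModules.free I) ≫
        (SheafOfModules.pushforward f.toRingCatSheafHom).map
          (SheafOfModules.pullbackObjFreeIso f.toRingCatSheafHom I).hom).val.app (op U)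
      (∑ i, a i • 𝔟[X.ringCatSheaf, i, op U]) =
    ∑ i, (f.app U (a i) : Γ(Y, f ⁻¹ᵁ U)) • 𝔟[Y.ringCatSheaf, i, op (f ⁻¹ᵁ U)] := by
  rw [map_sum]
  refine Finset.sum_congr rfl fun i _ => ?_
  have h : ((SheafOfModules.pullbackPushforwardAdjunction f.toRingCatSheafHom).unit.app
        (SheafOfModules.free I) ≫
        (SheafOfModules.pushforward f.toRingCatSheafHom).map
          (SheafOfModules.pullbackObjFreeIso f.toRingCatSheafHom I).hom).val.app (op U)
        𝔟[X.ringCatSheaf, i, op U] =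
      (SheafOfModules.ιFree (R := Y.ringCatSheaf) i).val.app (op (f ⁻¹ᵁ U)) (f.app U 1) :=
    congrArg (fun g => (SheafOfModules.Hom.val g).app (op U) (1 : Γ(X, U)))
      (ιFree_unit_pullbackObjFreeIso f I i)
  rw [map_smul, h, map_one]
  rfl

/-- The components of an isomorphism of sheaves of modules are bijective. -/
theorem val_app_bijective_of_iso {C : Type u₁} [Category.{v₁} C] {J : GrothendieckTopology C}
    {R : Sheaf J RingCat.{u}} {M N : SheafOfModules.{u} R} (e : M ≅ N) (c : Cᵒᵖ) :
    Function.Bijective (e.hom.val.app c) := by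
  have h1 : ∀ x, e.inv.val.app c (e.hom.val.app c x) = x := fun x =>
    congrArg (fun g => (SheafOfModules.Hom.val g).app c x) e.hom_inv_id
  have h2 : ∀ y, e.hom.val.app c (e.inv.val.app c y) = y := fun y =>
    congrArg (fun g => (SheafOfModules.Hom.val g).app c y) e.inv_hom_id
  exact ⟨Function.LeftInverse.injective h1, Function.RightInverse.surjective h2⟩

/-- **The unit on `𝒪_X^I` is surjective on sections over `U` when `f♯` is surjective on `U`.** -/
theorem unit_free_app_surjective (hf : Function.Surjective (f.app U)) :
    Function.Surjective (((SheafOfModules.pullbackPushforwardAdjunction f.toRingCatSheafHom).unit.app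
      (SheafOfModules.free I)).val.app (op U)) := by
  intro t
  -- coordinates on `Y` of the image of `t` in `f_* 𝒪_Y^I`
  obtain ⟨l', -, hgen', -⟩ := free_sections_basis (R := Y.ringCatSheaf) (I := I) (op (f ⁻¹ᵁ U))
  set e := SheafOfModules.pullbackObjFreeIso f.toRingCatSheafHom I with he
  let t' : (SheafOfModules.free (R := Y.ringCatSheaf) I).val.obj (op (f ⁻¹ᵁ U)) :=
    ((SheafOfModules.pushforward f.toRingCatSheafHom).map e.hom).val.app (op U) t
  choose a ha using fun i => hf (l' i t')
  refine ⟨∑ i, a i • 𝔟[X.ringCatSheaf, i, op U], ?_⟩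
  apply (val_app_bijective_of_iso ((SheafOfModules.pushforward f.toRingCatSheafHom).mapIso e)
    (op U)).1
  change ((SheafOfModules.pullbackPushforwardAdjunction f.toRingCatSheafHom).unit.app
      (SheafOfModules.free I) ≫ (SheafOfModules.pushforward f.toRingCatSheafHom).map e.hom).val.app
      (op U) _ = t'
  rw [unit_free_val_app_sum, hgen' t']
  exact Finset.sum_congr rfl fun i _ => by rw [ha]

/-- **The kernel of the unit on `𝒪_X^I` over `U`**: if `ker (f♯ on U) ⊆ (q)` for a natural number `q`,
a section of `𝒪_X^I` over `U` killed by the unit is a `q`-th multiple. -/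
theorem unit_free_app_eq_zero (q : ℕ) (hq : RingHom.ker (f.app U).hom ≤ Ideal.span {(q : Γ(X, U))})
    (s : (SheafOfModules.free (R := X.ringCatSheaf) I).val.obj (op U))
    (hs : ((SheafOfModules.pullbackPushforwardAdjunction f.toRingCatSheafHom).unit.app
      (SheafOfModules.free I)).val.app (op U) s = 0) :
    ∃ y : (SheafOfModules.free (R := X.ringCatSheaf) I).val.obj (op U), s = q • y := by
  obtain ⟨l, -, hgen, -⟩ := free_sections_basis (R := X.ringCatSheaf) (I := I) (op U)
  obtain ⟨l', -, -, hcoord'⟩ := free_sections_basis (R := Y.ringCatSheaf) (I := I) (op (f ⁻¹ᵁ U))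
  set e := SheafOfModules.pullbackObjFreeIso f.toRingCatSheafHom I with he
  -- the image of `s` in `f_* 𝒪_Y^I` vanishes, so the coordinates `f♯(l_i s)` vanish
  have h0 : ∑ i, (f.app U (l i s) : Γ(Y, f ⁻¹ᵁ U)) • 𝔟[Y.ringCatSheaf, i, op (f ⁻¹ᵁ U)] = 0 := by
    rw [← unit_free_val_app_sum, ← hgen s]
    change ((SheafOfModules.pushforward f.toRingCatSheafHom).map e.hom).val.app (op U)
      (((SheafOfModules.pullbackPushforwardAdjunction f.toRingCatSheafHom).unit.app
        (SheafOfModules.free I)).val.app (op U) s) = 0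
    rw [hs, map_zero]
  have hker : ∀ i, l i s ∈ RingHom.ker (f.app U).hom := fun i => by
    rw [RingHom.mem_ker]
    have h := hcoord' (fun j => f.app U (l j s)) i
    rwa [h0, map_zero, eq_comm] at h
  choose d hd using fun i => Ideal.mem_span_singleton'.mp (hq (hker i))
  refine ⟨∑ i, d i • 𝔟[X.ringCatSheaf, i, op U], ?_⟩
  rw [hgen s, Finset.smul_sum]
  refine Finset.sum_congr rfl fun i _ => ?_
  rw [← hd, mul_comm, mul_smul, Nat.cast_smul_eq_nsmul]

end UnitFree

/-- **Registered sub-goal** (helper stub of `stub_presentationAlgebraize`, universe `0`): sections of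
the unit of `f^* ⊣ f_*` on a free module of finite rank — surjective over `U` when `f♯` is, and with
kernel inside the `q`-th multiples when `ker f♯ ⊆ (q)` (`unit_free_app_surjective`,
`unit_free_app_eq_zero`). -/
theorem stub_unitFreeSections :
    ∀ (X Y : AlgebraicGeometry.Scheme.{0}) (f : Y ⟶ X) [(TopologicalSpace.Opens.map f.base).Final] (I : Type) [Fintype I] (U : X.Opens), (Function.Surjective (f.app U) → Function.Surjective (((SheafOfModules.pullbackPushforwardAdjunction (AlgebraicGeometry.Scheme.Hom.toRingCatSheafHom f)).unit.app (SheafOfModules.free I)).val.app (Opposite.op U))) ∧ ∀ (q : ℕ), RingHom.ker (f.app U).hom ≤ Ideal.span {(q : X.presheaf.obj (Opposite.op U))} → ∀ s : (SheafOfModules.free (R := X.ringCatSheaf) I).val.obj (Opposite.op U), ((SheafOfModules.pullbackPushforwardAdjunction (AlgebraicGeometry.Scheme.Hom.toRingCatSheafHom f)).unit.app (SheafOfModules.free I)).val.app (Opposite.op U) s = 0 → ∃ y : (SheafOfModules.free (R := X.ringCatSheaf) I).val.obj (Opposite.op U), s = q • y :=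
  fun _ _ f _ I _ U => ⟨fun hf => unit_free_app_surjective f I U hf,
    fun q hq s hs => unit_free_app_eq_zero f I U q hq s hs⟩

end Summit.HodgeConjecture.HodgeConjecture.Theorems.FormalVectorBundlesAlgebraize

end
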